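import Mathlib
import Summits.NavierStokesRegularity.NavierStokesRegularity.Theorems.TypeIQuarterGateQuarterZoomEnstrophyClock
import Summits.NavierStokesRegularity.NavierStokesRegularity.Theorems.GaldiLiouvilleGateParabolicGaldiLiouvilleSelfSimilarGate
import HarnessLib

/-!
# `TypeIQuarterGate`: the re-typed residual LRL is CLOSED for small ENSTROPHY clocks, and the
# quarter-law constant of a Type-I blow-up has a universal floor

Helper file (`--supports stmt-NavierStokesRegularity-23726`; theorems only, no definitions) for the
crux `QuarterLawTypeI` (K1, stmt-23726) and the residual `ParabolicGaldiLiouville` (X2, stmt-0893) of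
route `TypeIQuarterGate`.

The lineage re-typed the route's residual BY NAME (p821371 `typeIQuarterGate_of_lerayRateLiouville`)
to LRL = "Leray-rate Liouville in Galdi's parabolic class": a bounded ancient mild solution `v`
(`ν = 1`), smooth on `(−∞,0) × ℝ³`, with bounded slice enstrophy, `L⁶` slices, the velocity clock
`√(−s)‖v(s,y)‖ ≤ C'` and the ENSTROPHY CLOCK `∫|∇v(s)|²_F ≤ K'/√(−s)` vanishes identically; and it
closed the small-VELOCITY-clock corner (`typeIClockLiouville_small_clock`, p821782;
`typeIClockLiouville_smallConstant_subcase`, p821929).  This file closes the complementary corner in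
the ENSTROPHY currency, by name over the tree's Type-I enstrophy envelope of X2
(`ParabolicGaldiLiouville.Birth.parabolicGaldiLiouville_enstrophyEnvelope`: a universal `c > 0` such
that an X2-class flow with `∫|∇v(σ_k)|²_F · |σ_k|^{1/2} ≤ c` along SOME sequence `σ_k → −∞` vanishes):

* `eq_zero_of_smallEnstrophyClock` — there is a universal `κ₀ > 0` such that every X2-class flow with
  an enstrophy clock of constant `K' ≤ κ₀` vanishes (NO velocity clock needed);
* `lerayRateLiouville_smallEnstrophyClock` — hence LRL holds on the stratum `K' ≤ κ₀` (any `C'`), and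
  `lerayRateLiouville_iff_largeEnstrophyClock` — REDUCTION: LRL ⟺ LRL for enstrophy clocks `K' > κ₀`;
* `quarterLaw_constant_floor` — per solution, in K1's own currency: along a classical Leray–Hopf
  rapidly-decaying-datum solution on `[0,T)` with no smooth extension past `T` and the sup-norm Type-I
  rate, ANY constant `K` with `∫‖curl u(t)‖² ≤ K/√(T−t)` on `[0,T)` satisfies `K > κ₀ ν√ν` (the quarter
  zoom `QuarterZoomTypeIClock.quarterZoom_clocks_of_rate` would otherwise produce a NONTRIVIAL ancient
  flow with enstrophy clock `max K 0/(ν√ν) ≤ κ₀`).  This is the ancient-solution shadow of Leray's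
  lower bound `√(T−t)·∫|∇u(t)|² ≥ c ν^{3/2}` (Leray 1934 §20), recovered through the zoom with the
  universal constant of the X2 envelope;
* `quarterLawTypeI_constant_floor` — the same read on the crux: IF `QuarterLawTypeI` holds, the constant
  it provides along any Type-I blow-up of its class exceeds `κ₀ ν√ν`.

READING (repair census, 5th leafhand generation): the open core of LRL is the regime where BOTH clocks
are large — velocity clock `C' ≥ c₀` (p821929) and enstrophy clock `K' > κ₀` (this file); steady,
exactly self-similar, small-clock and (by boundedness) DSS members are all trivial or closed.
HONEST FRAMING: perturbative corners only; LRL, X2, K1 and Type-I exclusion remain OPEN; nothing here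
bears on Navier–Stokes regularity itself.  References: Leray, Acta Math. 63 (1934) §20;
Koch–Nadirashvili–Seregin–Šverák, Acta Math. 203 (2009) §6; Galdi (2011) §X.9.
-/

-- the problem directory repeats the summit name (D-0017); core's `dupNamespace` linter fires
set_option linter.dupNamespace false

noncomputable section

namespace Summit.NavierStokesRegularity.NavierStokesRegularity.Theorems

namespace LerayRateSmallClock

open Set MeasureTheory Filter Topology Function
open scoped ENNReal NNReal
open Literature.Analysis.FluidPDE
open ParabolicGaldiLiouville.Birth (parabolicGaldiLiouville_enstrophyEnvelope)
open QuarterZoomTypeIClock (quarterZoom_clocks_of_rate)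

/-! ### Elementary tools -/

/-- The times `σ_k = −(k+1)` are negative. [folklore] -/
theorem neg_natCast_add_one_neg (k : ℕ) : -((k : ℝ) + 1) < 0 := by
  have : (0 : ℝ) < (k : ℝ) + 1 := by positivity
  linarith

/-- An enstrophy clock `E ≤ K'/√(−σ)` at a time `σ < 0` gives `E · |σ|^{1/2} ≤ K'` (in `ℝ≥0∞`, with
`ofReal`; for `K' < 0` both sides vanish). [folklore] -/
theorem mul_rpow_half_le_of_clock {E : ℝ≥0∞} {K' σ : ℝ} (hσ : σ < 0)
    (h : E ≤ ENNReal.ofReal (K' / Real.sqrt (-σ))) :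
    E * ENNReal.ofReal ((-σ) ^ (1 / 2 : ℝ)) ≤ ENNReal.ofReal K' := by
  have hneg : 0 < -σ := by linarith
  have hsq : 0 < Real.sqrt (-σ) := Real.sqrt_pos.2 hneg
  have hrpow : (-σ) ^ (1 / 2 : ℝ) = Real.sqrt (-σ) := by
    rw [Real.sqrt_eq_rpow]
  rw [hrpow]
  calc E * ENNReal.ofReal (Real.sqrt (-σ))
      ≤ ENNReal.ofReal (K' / Real.sqrt (-σ)) * ENNReal.ofReal (Real.sqrt (-σ)) :=
        mul_le_mul' h le_rfl
    _ = ENNReal.ofReal (K' / Real.sqrt (-σ) * Real.sqrt (-σ)) :=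
        (ENNReal.ofReal_mul' hsq.le).symm
    _ = ENNReal.ofReal K' := by rw [div_mul_cancel₀ _ hsq.ne']

/-! ### The small-enstrophy-clock corner of X2 / LRL -/

/-- **X2-class flows with a SMALL enstrophy clock vanish.** There is a universal `κ₀ > 0` such that
every bounded ancient mild solution (`ν = 1`), smooth on `(−∞,0) × ℝ³`, with bounded slice enstrophy
and `L⁶` slices, whose enstrophy obeys the clock `∫|∇v(s)|²_F ≤ K'/√(−s)` for all `s < 0` with a
constant `K' ≤ κ₀`, vanishes identically (the tree's Type-I enstrophy envelope
`parabolicGaldiLiouville_enstrophyEnvelope` tested along `σ_k = −(k+1)`). [cite: Leray1934, §20] -/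
theorem eq_zero_of_smallEnstrophyClock :
    ∃ κ₀ : ℝ, 0 < κ₀ ∧ ∀ (K' : ℝ) (v : ℝ → EuclideanSpace ℝ (Fin 3) → EuclideanSpace ℝ (Fin 3)),
      IsBoundedAncientMildSolution 1 v →
      ContDiffOn ℝ (⊤ : ℕ∞) (Function.uncurry v) (Set.Iio 0 ×ˢ Set.univ) →
      (∃ C : NNReal, ∀ s < 0,
        ∫⁻ y, ENNReal.ofReal (frobeniusNormSq (fderiv ℝ (v s) y)) ≤ C) →
      (∀ s < 0, MemLp (v s) 6 volume) →
      (∀ s < 0, ∫⁻ y, ENNReal.ofReal (frobeniusNormSq (fderiv ℝ (v s) y)) ≤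
        ENNReal.ofReal (K' / Real.sqrt (-s))) →
      K' ≤ κ₀ → ∀ s < 0, ∀ y, v s y = 0 := by
  obtain ⟨c, hc0, hmain⟩ := parabolicGaldiLiouville_enstrophyEnvelope
  have hm0 : min c 1 ≠ 0 := (lt_min hc0 zero_lt_one).ne'
  have hmt : min c 1 ≠ ⊤ := ne_top_of_le_ne_top ENNReal.one_ne_top (min_le_right _ _)
  refine ⟨(min c 1).toReal, ENNReal.toReal_pos hm0 hmt, ?_⟩
  intro K' v hv hsm hens hL6 hclock hK' s hs y
  -- the test times `σ_k = −(k+1) → −∞`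
  have h1 : Tendsto (fun k : ℕ => (k : ℝ) + 1) atTop atTop :=
    tendsto_atTop_add_const_right atTop (1 : ℝ) tendsto_natCast_atTop_atTop
  have hσlim : Tendsto (fun k : ℕ => -((k : ℝ) + 1)) atTop atBot :=
    tendsto_neg_atTop_atBot.comp h1
  refine hmain v hv hsm hens hL6 ⟨fun k : ℕ => -((k : ℝ) + 1), hσlim,
    neg_natCast_add_one_neg, fun k => ?_⟩ s hs y
  have hσ : -((k : ℝ) + 1) < 0 := neg_natCast_add_one_neg k
  calc (∫⁻ y, ENNReal.ofReal (frobeniusNormSq (fderiv ℝ (v (-((k : ℝ) + 1))) y))) *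
        ENNReal.ofReal ((-(-((k : ℝ) + 1))) ^ (1 / 2 : ℝ))
      ≤ ENNReal.ofReal K' := mul_rpow_half_le_of_clock hσ (hclock _ hσ)
    _ ≤ ENNReal.ofReal (min c 1).toReal := ENNReal.ofReal_le_ofReal hK'
    _ = min c 1 := ENNReal.ofReal_toReal hmt
    _ ≤ c := min_le_left _ _

/-- **LRL holds on the stratum of small enstrophy clocks.** With the universal `κ₀` of
`eq_zero_of_smallEnstrophyClock`: a flow of the LRL class (X2 class + velocity clock `C'` + enstrophy
clock `K'`) with `K' ≤ κ₀` vanishes identically, whatever `C'` is. [cite: Leray1934, §20] -/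
theorem lerayRateLiouville_smallEnstrophyClock :
    ∃ κ₀ : ℝ, 0 < κ₀ ∧ ∀ (K' : ℝ) (v : ℝ → EuclideanSpace ℝ (Fin 3) → EuclideanSpace ℝ (Fin 3)),
      IsBoundedAncientMildSolution 1 v →
      ContDiffOn ℝ (⊤ : ℕ∞) (Function.uncurry v) (Set.Iio 0 ×ˢ Set.univ) →
      (∃ C : NNReal, ∀ s < 0,
        ∫⁻ y, ENNReal.ofReal (frobeniusNormSq (fderiv ℝ (v s) y)) ≤ C) →
      (∀ s < 0, MemLp (v s) 6 volume) →
      (∃ C' : ℝ, 0 ≤ C' ∧ ∀ s < 0, ∀ y, Real.sqrt (-s) * ‖v s y‖ ≤ C') →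
      (∀ s < 0, ∫⁻ y, ENNReal.ofReal (frobeniusNormSq (fderiv ℝ (v s) y)) ≤
        ENNReal.ofReal (K' / Real.sqrt (-s))) →
      K' ≤ κ₀ → ∀ s < 0, ∀ y, v s y = 0 := by
  obtain ⟨κ₀, hκ₀, h⟩ := eq_zero_of_smallEnstrophyClock
  exact ⟨κ₀, hκ₀, fun K' v hv hsm hens hL6 _ hclock hK' => h K' v hv hsm hens hL6 hclock hK'⟩


/-- **REDUCTION: LRL ⟺ LRL for LARGE enstrophy clocks.** With the universal `κ₀` of
`eq_zero_of_smallEnstrophyClock`, the re-typed residual LRL (hypothesis `hLRL` of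
`typeIQuarterGate_of_lerayRateLiouville`, spelled inline) is equivalent to its restriction to flows
whose enstrophy clock constant exceeds `κ₀`. [cite: Leray1934, §20] -/
theorem lerayRateLiouville_iff_largeEnstrophyClock :
    ∃ κ₀ : ℝ, 0 < κ₀ ∧
      ((∀ v : ℝ → EuclideanSpace ℝ (Fin 3) → EuclideanSpace ℝ (Fin 3),
        IsBoundedAncientMildSolution 1 v →
        ContDiffOn ℝ (⊤ : ℕ∞) (Function.uncurry v) (Set.Iio 0 ×ˢ Set.univ) →
        (∃ C : NNReal, ∀ s < 0,
          ∫⁻ y, ENNReal.ofReal (frobeniusNormSq (fderiv ℝ (v s) y)) ≤ C) →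
        (∀ s < 0, MemLp (v s) 6 volume) →
        (∃ C' : ℝ, 0 ≤ C' ∧ ∀ s < 0, ∀ y, Real.sqrt (-s) * ‖v s y‖ ≤ C') →
        (∃ K' : ℝ, 0 ≤ K' ∧ ∀ s < 0, ∫⁻ y, ENNReal.ofReal (frobeniusNormSq (fderiv ℝ (v s) y)) ≤
          ENNReal.ofReal (K' / Real.sqrt (-s))) →
        ∀ s < 0, ∀ y, v s y = 0) ↔
      (∀ v : ℝ → EuclideanSpace ℝ (Fin 3) → EuclideanSpace ℝ (Fin 3),
        IsBoundedAncientMildSolution 1 v →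
        ContDiffOn ℝ (⊤ : ℕ∞) (Function.uncurry v) (Set.Iio 0 ×ˢ Set.univ) →
        (∃ C : NNReal, ∀ s < 0,
          ∫⁻ y, ENNReal.ofReal (frobeniusNormSq (fderiv ℝ (v s) y)) ≤ C) →
        (∀ s < 0, MemLp (v s) 6 volume) →
        (∃ C' : ℝ, 0 ≤ C' ∧ ∀ s < 0, ∀ y, Real.sqrt (-s) * ‖v s y‖ ≤ C') →
        (∃ K' : ℝ, κ₀ < K' ∧ ∀ s < 0, ∫⁻ y, ENNReal.ofReal (frobeniusNormSq (fderiv ℝ (v s) y)) ≤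
          ENNReal.ofReal (K' / Real.sqrt (-s))) →
        ∀ s < 0, ∀ y, v s y = 0)) := by
  obtain ⟨κ₀, hκ₀, hsmall⟩ := eq_zero_of_smallEnstrophyClock
  refine ⟨κ₀, hκ₀, fun hLRL v hv hsm hens hL6 hvel hK => ?_, fun hlarge v hv hsm hens hL6 hvel hK => ?_⟩
  · obtain ⟨K', hK', hclock⟩ := hK
    exact hLRL v hv hsm hens hL6 hvel ⟨K', hκ₀.le.trans hK'.le, hclock⟩
  · obtain ⟨K', -, hclock⟩ := hK
    rcases le_or_gt K' κ₀ with hle | hlt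
    · exact hsmall K' v hv hsm hens hL6 hclock hle
    · exact hlarge v hv hsm hens hL6 hvel ⟨K', hlt, hclock⟩

/-! ### The floor of the quarter-law constant along a Type-I blow-up -/

/-- **The quarter-law constant of a Type-I blow-up exceeds `κ₀ ν√ν`.** For a classical Leray–Hopf
solution on `[0,T)` from a rapidly decaying datum with no smooth extension past `T` and the sup-norm
Type-I rate at `T`: every `K` with `∫‖curl u(t)‖² ≤ K/√(T−t)` on `[0,T)` satisfies `κ₀ ν√ν < K`, where
`κ₀` is the universal constant of `eq_zero_of_smallEnstrophyClock` — otherwise the quarter zoom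
(`quarterZoom_clocks_of_rate`) is a NONTRIVIAL X2-class flow with enstrophy clock `max K 0/(ν√ν) ≤ κ₀`.
The ancient-solution shadow of Leray's lower bound `√(T−t)∫|∇u(t)|² ≥ cν^{3/2}`. [cite: Leray1934, §20]
[cite: KochNadirashviliSereginSverak2009, §6] -/
theorem quarterLaw_constant_floor :
    ∃ κ₀ : ℝ, 0 < κ₀ ∧ ∀ (ν T : ℝ), 0 < ν → 0 < T →
      ∀ (u : ℝ → EuclideanSpace ℝ (Fin 3) → EuclideanSpace ℝ (Fin 3))
        (p : ℝ → EuclideanSpace ℝ (Fin 3) → ℝ),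
      IsClassicalNSSolutionOn (Set.Ico 0 T) ν 0 u p → IsLerayHopfOn T ν 0 (u 0) u →
      HasRapidSpatialDecay (u 0) → ¬ HasSmoothExtensionPast ν 0 u T → IsTypeIBlowup u T →
      ∀ K : ℝ, (∀ t ∈ Set.Ico 0 T,
        ∫⁻ x, ‖curl (u t) x‖ₑ ^ 2 ≤ ENNReal.ofReal (K / Real.sqrt (T - t))) →
      κ₀ * (ν * Real.sqrt ν) < K := by
  obtain ⟨κ₀, hκ₀, hsmall⟩ := eq_zero_of_smallEnstrophyClock
  refine ⟨κ₀, hκ₀, ?_⟩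
  intro ν T hν hT u p hcl hLH hdec hnext hI K hK
  obtain ⟨CI, hCI⟩ := hI
  obtain ⟨v, hv, hsm, hens, hL6, hne, -, hensclock⟩ :=
    quarterZoom_clocks_of_rate ν T hν hT u p hcl hLH hdec hnext CI hCI K hK
  have hνs : 0 < ν * Real.sqrt ν := mul_pos hν (Real.sqrt_pos.2 hν)
  by_contra hlt
  have hle : K ≤ κ₀ * (ν * Real.sqrt ν) := not_lt.1 hlt
  -- the zoom's enstrophy clock has constant `max K 0/(ν√ν) ≤ κ₀`
  have hK' : max K 0 / (ν * Real.sqrt ν) ≤ κ₀ := by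
    rw [div_le_iff₀ hνs]
    exact max_le hle (le_of_lt (mul_pos hκ₀ hνs))
  have hclock : ∀ s < 0, ∫⁻ y, ENNReal.ofReal (frobeniusNormSq (fderiv ℝ (v s) y)) ≤
      ENNReal.ofReal (max K 0 / (ν * Real.sqrt ν) / Real.sqrt (-s)) := fun s hs => by
    rw [div_div]
    exact hensclock s hs
  exact hne (hsmall _ v hv hsm ⟨1, fun s hs => le_of_le_of_eq (hens s hs) ENNReal.coe_one.symm⟩
    hL6 hclock hK')

/-- **On the crux `QuarterLawTypeI` (stmt-23726): its constant has a universal floor.** If K1 holds,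
then along every maximal classical Leray–Hopf rapidly-decaying-datum solution with the Type-I rate the
constant `K` it yields satisfies, a fortiori, `∃ K, κ₀ ν√ν < K ∧ (the quarter law with K)`: the quarter
law can only hold with constants above Leray's floor (zoom form). [cite: Leray1934, §20] -/
theorem quarterLawTypeI_constant_floor
    (hQ : Summit.NavierStokesRegularity.NavierStokesRegularity.Theses.TypeIQuarterGate.QuarterLawTypeI) :
    ∃ κ₀ : ℝ, 0 < κ₀ ∧ ∀ (ν T : ℝ), 0 < ν → 0 < T →
      ∀ (u : ℝ → EuclideanSpace ℝ (Fin 3) → EuclideanSpace ℝ (Fin 3))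
        (p : ℝ → EuclideanSpace ℝ (Fin 3) → ℝ),
      IsMaximalSmoothSolution ν 0 u p T → IsLerayHopfOn T ν 0 (u 0) u →
      HasRapidSpatialDecay (u 0) → IsTypeIBlowup u T →
      ∃ K : ℝ, κ₀ * (ν * Real.sqrt ν) < K ∧ ∀ t ∈ Set.Ico 0 T,
        ∫⁻ x, ‖curl (u t) x‖ₑ ^ 2 ≤ ENNReal.ofReal (K / Real.sqrt (T - t)) := by
  obtain ⟨κ₀, hκ₀, hfloor⟩ := quarterLaw_constant_floor
  refine ⟨κ₀, hκ₀, fun ν T hν hT u p hmax hLH hdec hI => ?_⟩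
  obtain ⟨K, hK⟩ := hQ ν T hν hT u p hmax hLH hdec hI
  exact ⟨K, hfloor ν T hν hT u p hmax.1 hLH hdec hmax.2 hI K hK, hK⟩

end LerayRateSmallClock

end Summit.NavierStokesRegularity.NavierStokesRegularity.Theorems

end
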